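import Mathlib
import Summits.MatrixMultiplication.Statement
import Summits.MatrixMultiplication.MatrixMultiplication.Theorems.GraphEquationsExactEngineTwo

/-!
# Graph equations — fields for the HIGHER levels of the e-engine: no max-rank base needed (M19n)

At level `k ≥ 2` of the membership-exponent engine the base cannot be assumed to be of maximal rank for
the DERIVED row matrix (NODE-g32 REV 10).  What the exact-members engine needs is only V0/V1, and
`section01_of_kernelSection` (M19l) has no rank hypothesis.  This module packages the base-free field
supply:

* `Submodule.exists_mem_generic'` — every subspace `V ⊆ ℂ^κ` contains a vector that is non-zero in every
  coordinate in which SOME element of `V` is non-zero (generalises `exists_kernel_generic`);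
* `exists_sectionValue_generic` — for any polynomial matrix `A`, some EXACT polynomial kernel section
  `η` (`A η = 0`) has `η(0)` non-zero in every coordinate in which some exact section's value is;
* `exists_affField_V01_of_kernelSection` — the 1-jet at `0` of ANY exact kernel section of the row
  matrix of ANY family `t` is a cost-free affine field with V0/V1 for all deflated `t_o`, with value
  `η(0)` (no rank hypothesis, `t` need not lie in `I`).
-/

set_option linter.dupNamespace false

noncomputable section

open scoped BigOperators

namespace Summit.MatrixMultiplication.MatrixMultiplication.Theorems.GraphEquations

open MvPolynomial
open Literature.Computability.AlgebraicComplexity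
open Literature.Computability.AlgebraicComplexity.ArithCircuit

variable {n : ℕ}

/-! ## Generic elements of a subspace -/

/-- **Generic element of a subspace of `ℂ^κ`.** -/
theorem Submodule.exists_mem_generic' {κ : Type*} [Fintype κ] [DecidableEq κ]
    (V : Submodule ℂ (κ → ℂ)) :
    ∃ γ ∈ V, ∀ i, (∃ γ' ∈ V, γ' i ≠ 0) → γ i ≠ 0 := by
  classical
  have hw : ∀ i : κ, ∃ w : κ → ℂ, w ∈ V ∧ ((∃ γ' ∈ V, γ' i ≠ 0) → w i ≠ 0) := by
    intro i
    by_cases h : ∃ γ' ∈ V, γ' i ≠ 0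
    · obtain ⟨γ', h1, h2⟩ := h
      exact ⟨γ', h1, fun _ => h2⟩
    · exact ⟨0, V.zero_mem, fun h' => absurd h' h⟩
  choose w hwV hwne using hw
  let e : κ → ℕ := fun i => (Fintype.equivFin κ i : ℕ)
  have he : Function.Injective e := fun i i' h => (Fintype.equivFin κ).injective (Fin.ext h)
  let p : κ → Polynomial ℂ := fun i₀ => ∑ i, Polynomial.C (w i i₀) * Polynomial.X ^ e i
  have hp_coeff : ∀ i₀, (p i₀).coeff (e i₀) = w i₀ i₀ := by
    intro i₀
    simp only [p, Polynomial.finsetSum_coeff, Polynomial.coeff_C_mul, Polynomial.coeff_X_pow]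
    rw [Finset.sum_eq_single i₀ (fun i _ hi => by rw [if_neg (fun h => hi (he h.symm)), mul_zero])
      (fun h => absurd (Finset.mem_univ i₀) h), if_pos rfl, mul_one]
  have hp_ne : ∀ i₀, (∃ γ' ∈ V, γ' i₀ ≠ 0) → p i₀ ≠ 0 :=
    fun i₀ h hp0 => hwne i₀ h (by rw [← hp_coeff, hp0, Polynomial.coeff_zero])
  have hp_eval : ∀ i₀ (s : ℂ), (p i₀).eval s = ∑ i, s ^ e i * w i i₀ := by
    intro i₀ s
    simp only [p, Polynomial.eval_finsetSum, Polynomial.eval_mul, Polynomial.eval_C,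
      Polynomial.eval_pow, Polynomial.eval_X]
    exact Finset.sum_congr rfl fun i _ => mul_comm _ _
  let bad : Finset ℂ := Finset.univ.biUnion fun i₀ => (p i₀).roots.toFinset
  obtain ⟨k, hk⟩ := Infinite.exists_notMem_finset
    (bad.preimage (Nat.cast : ℕ → ℂ) Nat.cast_injective.injOn)
  set s : ℂ := (k : ℂ) with hs
  have hsbad : s ∉ bad := fun h => hk (Finset.mem_preimage.mpr h)
  refine ⟨fun i' => ∑ i, s ^ e i * w i i', ?_, fun i₀ hi₀ h0 => ?_⟩
  · have hfun : (fun i' => ∑ i, s ^ e i * w i i') = ∑ i, s ^ e i • w i := by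
      funext i'
      simp only [Finset.sum_apply, Pi.smul_apply, smul_eq_mul]
    rw [hfun]
    exact V.sum_mem fun i _ => V.smul_mem _ (hwV i)
  · have h0' : ∑ i, s ^ e i * w i i₀ = 0 := h0
    have hroot : s ∈ (p i₀).roots.toFinset := by
      rw [Multiset.mem_toFinset, Polynomial.mem_roots (hp_ne i₀ hi₀), Polynomial.IsRoot.def,
        hp_eval, h0']
    exact hsbad (Finset.mem_biUnion.mpr ⟨i₀, Finset.mem_univ _, hroot⟩)

/-! ## Generic values of exact kernel sections -/

/-- **Some exact polynomial kernel section has a GENERIC value at `0`:** non-zero in every coordinate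
in which some exact section's value at `0` is non-zero.  No rank hypothesis. -/
theorem exists_sectionValue_generic {σ ι κ : Type*} [Fintype ι] [Fintype κ] [DecidableEq κ]
    (A : Matrix ι κ (MvPolynomial σ ℂ)) :
    ∃ η : κ → MvPolynomial σ ℂ, A.mulVec η = 0 ∧
      ∀ i, (∃ η' : κ → MvPolynomial σ ℂ, A.mulVec η' = 0 ∧ eval 0 (η' i) ≠ 0) → eval 0 (η i) ≠ 0 := by
  classical
  -- the ℂ-subspace of exact sections and its space of values at `0`
  let K : Submodule ℂ (κ → MvPolynomial σ ℂ) := LinearMap.ker ((Matrix.mulVecLin A).restrictScalars ℂ)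
  let F : (κ → MvPolynomial σ ℂ) →ₗ[ℂ] (κ → ℂ) :=
    ((MvPolynomial.aeval (0 : σ → ℂ)).toLinearMap).compLeft κ
  have hF : ∀ (η : κ → MvPolynomial σ ℂ) (i : κ), F η i = eval 0 (η i) := by
    intro η i
    simp only [F, LinearMap.compLeft_apply, Function.comp_apply, AlgHom.toLinearMap_apply]
    rw [MvPolynomial.aeval_eq_eval]
  have hK : ∀ η : κ → MvPolynomial σ ℂ, η ∈ K ↔ A.mulVec η = 0 := by
    intro η
    simp only [K, LinearMap.mem_ker, LinearMap.restrictScalars_apply, Matrix.mulVecLin_apply]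
  obtain ⟨γ, hγV, hgen⟩ := Submodule.exists_mem_generic' (K.map F)
  obtain ⟨η, hηK, rfl⟩ := Submodule.mem_map.mp hγV
  refine ⟨η, (hK η).mp hηK, fun i ⟨η', hη', hne⟩ => ?_⟩
  rw [← hF]
  exact hgen i ⟨F η', Submodule.mem_map.mpr ⟨η', (hK η').mpr hη', rfl⟩, by rw [hF]; exact hne⟩

/-! ## V0/V1 fields from ANY exact kernel section of the row matrix -/

/-- **Base-free field supply.**  For any family `t` and any exact polynomial kernel section `η` of its
row matrix (`Σ_q r_q(t_o) η_q = 0` for all `o`), the 1-jet of `η` at `0` is a cost-free affine field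
`ξ` with `ξ(0) = η(0)` whose deflated `t_o` satisfy V0 and V1. -/
theorem exists_affField_V01_of_kernelSection {T : ℕ} (t : Fin T → MvPolynomial (GraphVars n) ℂ)
    (η : Fin n × Fin n → MvPolynomial (MatMulVars n) ℂ)
    (hker : ∀ o, ∑ q, rowPoly (t o) q * η q = 0) :
    ∃ lam : Fin n × Fin n → MatMulVars n → ℂ,
      (∀ q, liftAB n (affField (fun q => eval 0 (η q)) lam q) ∈
        freeSpan (∅ : Set (MvPolynomial (GraphVars n) ℂ))) ∧
      (∀ q, coeff 0 (affField (fun q => eval 0 (η q)) lam q) = eval 0 (η q)) ∧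
      (∀ o, coeff 0 (derivC (affField (fun q => eval 0 (η q)) lam) (t o)) = 0) ∧
      ∀ o (v : MatMulVars n), coeff (Finsupp.single (Sum.inl v : GraphVars n) 1)
        (derivC (affField (fun q => eval 0 (η q)) lam) (t o)) = 0 := by
  obtain ⟨lam, hsec⟩ := section01_of_kernelSection (fun o q => rowPoly (t o) q) (fun q => eval 0 (η q))
    η one_ne_zero hker (fun q => by rw [one_mul])
  have hsec' : ∀ (o : Fin T) (m : MatMulVars n →₀ ℕ), m.degree ≤ 1 →
      coeff m (∑ q, affField (fun q => eval 0 (η q)) lam q * rowPoly (t o) q) = 0 := hsec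
  obtain ⟨hV0, hV1⟩ := derivC_V01_of_section01 t (affField (fun q => eval 0 (η q)) lam) hsec'
  exact ⟨lam, liftAB_affField_mem_freeSpan _ lam, coeff_zero_affField _ lam, hV0, hV1⟩

end Summit.MatrixMultiplication.MatrixMultiplication.Theorems.GraphEquations

end
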